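import Summits.AtomisticToContinuum.HydrodynamicLimit.Theorems.OneFlightGossipEngineClampedTransferDockBridgeDefs
import Summits.AtomisticToContinuum.HydrodynamicLimit.Theorems.JParityClosureOddContactSymmetryGibbsInvariance
import Summits.AtomisticToContinuum.HydrodynamicLimit.Theorems.RelayRaceLocalityRestartPrincipleLineGlue
import Summits.AtomisticToContinuum.HydrodynamicLimit.Theorems.RelayRaceLocalityNearConstantShortTimeHLEntropyPrice
import Summits.AtomisticToContinuum.HydrodynamicLimit.Theorems.LambertianContactSwapSwapGapGibbsDomination
import Summits.AtomisticToContinuum.HydrodynamicLimit.Theorems.ImplosionDichotomyHydroLimitInBandWindowContinuityFields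
import HarnessLib

/-!
# The global-Gibbs entropy bridge (stub `stub_bridgeTransfer`, line `Sketch`, crux `ClampedTransferDock`, stmt-16665)

Registered stub `stub_bridgeTransfer : EquilibriumNonBlobCoherenceLD → BoundedCoherentContentVanishes` of the skeleton
`Cruxes/ClampedTransferDock/Lines/Sketch.lean` (card `gibbs-budget-coherence-bridge`); both propositions are the defs file's
(`…OneFlightGossipEngineClampedTransferDockBridgeDefs`).

THE BRIDGE (§1, adapted from the crux workfile `Cruxes/ClampedTransferDock/IdeatorOneSketch.lean` §1). The relative entropy of
the TRUE pre-shock law at time `s` w.r.t. the HOMOGENEOUS Gibbs law `G_N = localGibbsLaw σ 1 0 1` is conserved by Liouville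
(`map_flow_localGibbsLaw_const`, `klDiv_lawAt_lawAt`) and equals the static budget `KL(λ_N ‖ G_N) ≤ A (N+1)`
(`exists_localGibbsLaw_dominated`), so the entropy inequality (`integral_comp_flow_le_klDiv_add_log_of_nonneg`) prices an
EQUILIBRIUM event `E` with `G_N(E) ≤ e^{-r(N+1)}` at `≤ (A(N+1) + log 2)/(r(N+1))` under `λ_N ∘ Φ_s⁻¹` at EVERY time `s`.

THE STUB (§3). The Euler velocity is bounded by `U` and `L`-Lipschitz in space on the slab `[0, (t+T)/2] × 𝕋³`
(`exists_lipschitz_slab`); the equilibrium input at `(U, L, K⋆, K, η)` gives the drift ceiling `D₁`; given `D₀ ≤ D₁, r₀, ε` take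
`δ = ε/3`, the rate `r = 3K³(A+1)/ε`, and pass the equilibrium thresholds `κ₀, τ₀, N₀` on. At `N ≥ N₀`, weight `R`,
`s ∈ [0, t]`: the window functional `S_s` of `BoundedCoherentContentVanishes` (window `[s, s+w]`, frozen field `u_s`) is, on the
good set, the equilibrium functional `S₀` (window `[0, w]`, same field) composed with `Φ_s` (§2, `integral_window_shift`), and
`0 ≤ S_s ≤ K³`; hence `E_λ[S_s] ≤ δ + K³ λ_N(Φ_s ∈ {δ < S₀}) ≤ ε/3 + K³ (A(N+1) + log 2)/(r(N+1)) ≤ ε`.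

prover-line-stmt-AtomisticToContinuum-16665-0 (stub worker `stub_bridgeTransfer`).
-/

noncomputable section

namespace Summit.AtomisticToContinuum.HydrodynamicLimit.Theorems.ClampedTransferDockBridge

open scoped BigOperators ENNReal Classical
open MeasureTheory Set Filter InformationTheory
open Literature.MathematicalPhysics.KineticTheory Literature.Analysis.FluidPDE Literature.Analysis.FunctionSpaces
open Summit.AtomisticToContinuum.HydrodynamicLimit.Theorems
open Summit.AtomisticToContinuum.HydrodynamicLimit.Theorems.ClampedCurrentsDockCubicChannelPrelim (integral_window_shift)
open Summit.AtomisticToContinuum.HydrodynamicLimit.Theorems.HydroLimitInBandContinuity (exists_lipschitz_slab)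
open Summit.AtomisticToContinuum.HydrodynamicLimit.Theorems.EntropyClockDock (ae_mem_good_localGibbsLaw)

variable {σ : ℝ} {N : ℕ}

/-! ## §1 The global-Gibbs budget -/

-- adapted from Cruxes/ClampedTransferDock/IdeatorOneSketch.lean §1 (the five declarations of this section)

/-- The homogeneous (global) Gibbs law of `N+1` hard spheres at reduced diameter `σ`: constant activity `ab`,
zero drift, constant temperature `θb`. [folklore] -/
abbrev globalGibbs (σ ab θb : ℝ) (N : ℕ) (Φ : HardSphereFlow (Torus.geometry (Fin 3)) (hsDiameter σ N) (N + 1)) :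
    Measure (Config (N + 1) (Fin 3) T3) :=
  localGibbsLaw σ (fun _ => ab) (fun _ => (0 : V3)) (fun _ => θb) N Φ

/-- Stationarity: the law at time `s` of the global Gibbs law is the global Gibbs law
(tree theorem `map_flow_localGibbsLaw_const`). [folklore] -/
theorem lawAt_globalGibbs (ab θb : ℝ)
    (Φ : HardSphereFlow (Torus.geometry (Fin 3)) (hsDiameter σ N) (N + 1)) (s : ℝ) :
    Φ.lawAt (globalGibbs σ ab θb N Φ) s = globalGibbs σ ab θb N Φ := by
  rw [HardSphereFlow.lawAt_eq]
  exact map_flow_localGibbsLaw_const σ ab θb 0 N Φ s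

/-- **Liouville transports the relative entropy with respect to global Gibbs unchanged**: for every finite
Liouville-a.c. initial law `μ` and every time `s`, `KL((Φ_s)_* μ ‖ G_N) = KL(μ ‖ G_N)`. [folklore] -/
theorem klDiv_lawAt_globalGibbs (ab θb : ℝ)
    (Φ : HardSphereFlow (Torus.geometry (Fin 3)) (hsDiameter σ N) (N + 1))
    (μ : Measure (Config (N + 1) (Fin 3) T3)) [IsFiniteMeasure μ]
    (hμ : μ ≪ liouville (Torus.geometry (Fin 3)) (N + 1) (hsDiameter σ N))
    [IsFiniteMeasure (globalGibbs σ ab θb N Φ)] (s : ℝ) :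
    klDiv (Φ.lawAt μ s) (globalGibbs σ ab θb N Φ) = klDiv μ (globalGibbs σ ab θb N Φ) := by
  have h := RestartPrinciple.IsentropicRegibbsification.klDiv_lawAt_lawAt Φ μ (globalGibbs σ ab θb N Φ) hμ
    (RestartPrinciple.IsentropicRegibbsification.localGibbsLaw_ac σ _ _ _ N Φ) s
  rwa [lawAt_globalGibbs ab θb Φ s] at h

/-- **The Guo–Papanicolaou–Varadhan transfer with the global budget.** For a Liouville-a.c. initial probability law
`P` with `KL(P ‖ G_N) < ∞`, every time `s`, every measurable nonnegative phase-space functional `Y` with `Y ∘ Φ_s`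
integrable, every `c > 0`: an equilibrium exponential-moment bound `∫ e^{cY} dG_N ≤ e^κ` is paid under the TRUE law at
time `s` with the INITIAL budget, `E_P[Y ∘ Φ_s] ≤ c⁻¹ (KL(P ‖ G_N) + κ)`. [folklore] -/
theorem globalGibbsBudget_integral (ab θb : ℝ)
    (Φ : HardSphereFlow (Torus.geometry (Fin 3)) (hsDiameter σ N) (N + 1))
    (P : Measure (Config (N + 1) (Fin 3) T3)) [IsProbabilityMeasure P]
    (hP : P ≪ liouville (Torus.geometry (Fin 3)) (N + 1) (hsDiameter σ N))
    [IsProbabilityMeasure (globalGibbs σ ab θb N Φ)]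
    (hfin : klDiv P (globalGibbs σ ab θb N Φ) ≠ ⊤) (s : ℝ)
    {Y : Config (N + 1) (Fin 3) T3 → ℝ} (hY : Measurable Y) (hY0 : ∀ z, 0 ≤ Y z)
    (hint : Integrable (fun z => Y (Φ.flow s z)) P) {c κ : ℝ} (hc : 0 < c)
    (hmgf : ∫⁻ z, ENNReal.ofReal (Real.exp (c * Y z)) ∂(globalGibbs σ ab θb N Φ) ≤
      ENNReal.ofReal (Real.exp κ)) :
    ∫ z, Y (Φ.flow s z) ∂P ≤ c⁻¹ * ((klDiv P (globalGibbs σ ab θb N Φ)).toReal + κ) := by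
  have hfin' : klDiv (Φ.lawAt P s) (globalGibbs σ ab θb N Φ) ≠ ⊤ := by
    rwa [klDiv_lawAt_globalGibbs ab θb Φ P hP s]
  have h := NearConstantShortTimeHL.integral_comp_flow_le_klDiv_add_log_of_nonneg Φ P
    (globalGibbs σ ab θb N Φ) s hfin' hY hY0 hint hc hmgf
  rwa [klDiv_lawAt_globalGibbs ab θb Φ P hP s] at h

/-- **Event form of the bridge.** An EQUILIBRIUM event of probability `≤ e^{-K}` has TRUE-law probability at every
time `s` at most `(KL(P ‖ G_N) + log 2)/K`. [folklore] -/
theorem globalGibbsBudget_event (ab θb : ℝ)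
    (Φ : HardSphereFlow (Torus.geometry (Fin 3)) (hsDiameter σ N) (N + 1))
    (P : Measure (Config (N + 1) (Fin 3) T3)) [IsProbabilityMeasure P]
    (hP : P ≪ liouville (Torus.geometry (Fin 3)) (N + 1) (hsDiameter σ N))
    [IsProbabilityMeasure (globalGibbs σ ab θb N Φ)]
    (hfin : klDiv P (globalGibbs σ ab θb N Φ) ≠ ⊤) (s : ℝ)
    {A : Set (Config (N + 1) (Fin 3) T3)} (hA : MeasurableSet A) {K : ℝ} (hK : 0 < K)
    (hGA : (globalGibbs σ ab θb N Φ) A ≤ ENNReal.ofReal (Real.exp (-K))) :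
    (P ((Φ.flow s) ⁻¹' A)).toReal ≤ K⁻¹ * ((klDiv P (globalGibbs σ ab θb N Φ)).toReal + Real.log 2) := by
  set G := globalGibbs σ ab θb N Φ with hG
  -- the functional `Y = K · 𝟙_A`
  set Y : Config (N + 1) (Fin 3) T3 → ℝ := A.indicator (fun _ => K) with hY
  have hYm : Measurable Y := measurable_const.indicator hA
  have hY0 : ∀ z, 0 ≤ Y z := fun z => by simp only [hY, Set.indicator_apply]; split_ifs <;> [exact hK.le; exact le_rfl]
  have hYle : ∀ z, Y z ≤ K := fun z => by simp only [hY, Set.indicator_apply]; split_ifs <;> [exact le_rfl; exact hK.le]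
  -- `Y ∘ Φ_s` is bounded measurable, hence integrable under the probability measure `P`
  have hint : Integrable (fun z => Y (Φ.flow s z)) P := by
    refine (integrable_const K).mono' (hYm.comp (Φ.measurable_flow s)).aestronglyMeasurable
      (Eventually.of_forall fun z => ?_)
    rw [Real.norm_eq_abs, abs_of_nonneg (hY0 _)]
    exact hYle _
  -- equilibrium exponential moment: `∫ e^{Y} dG = G(Aᶜ)·1 + G(A)·e^K ≤ 1 + 1 = 2`
  have hmgf : ∫⁻ z, ENNReal.ofReal (Real.exp (1 * Y z)) ∂G ≤ ENNReal.ofReal (Real.exp (Real.log 2)) := by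
    have hptw : ∀ z, ENNReal.ofReal (Real.exp (1 * Y z)) ≤
        1 + A.indicator (fun _ => ENNReal.ofReal (Real.exp K)) z := by
      intro z
      by_cases hz : z ∈ A
      · simp only [hY, one_mul, Set.indicator_of_mem hz]; exact le_add_self
      · simp only [hY, one_mul, Set.indicator_of_notMem hz, Real.exp_zero, ENNReal.ofReal_one, add_zero]; exact le_rfl
    calc ∫⁻ z, ENNReal.ofReal (Real.exp (1 * Y z)) ∂G
        ≤ ∫⁻ z, (1 + A.indicator (fun _ => ENNReal.ofReal (Real.exp K)) z) ∂G := lintegral_mono hptw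
      _ = 1 + ENNReal.ofReal (Real.exp K) * G A := by
          rw [lintegral_add_left measurable_const, lintegral_const, measure_univ, mul_one,
            lintegral_indicator hA, setLIntegral_const]
      _ ≤ 1 + ENNReal.ofReal (Real.exp K) * ENNReal.ofReal (Real.exp (-K)) := by gcongr
      _ = ENNReal.ofReal (Real.exp (Real.log 2)) := by
          rw [← ENNReal.ofReal_mul (Real.exp_pos K).le, ← Real.exp_add, add_neg_cancel, Real.exp_zero,
            ENNReal.ofReal_one, Real.exp_log two_pos]
          norm_num
  have h := globalGibbsBudget_integral ab θb Φ P hP hfin s hYm hY0 hint one_pos hmgf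
  -- `∫ Y ∘ Φ_s dP = K · P(Φ_s⁻¹ A)`
  have hval : ∫ z, Y (Φ.flow s z) ∂P = K * (P ((Φ.flow s) ⁻¹' A)).toReal := by
    have : (fun z => Y (Φ.flow s z)) = ((Φ.flow s) ⁻¹' A).indicator (fun _ => K) := by
      funext z; simp only [hY, Set.indicator_apply, Set.mem_preimage]
    rw [this, integral_indicator_const _ ((Φ.measurable_flow s) hA), smul_eq_mul, mul_comm]
    rfl
  rw [hval, inv_one, one_mul] at h
  -- divide by `K > 0`
  have hKinv : 0 < K⁻¹ := inv_pos.mpr hK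
  calc (P ((Φ.flow s) ⁻¹' A)).toReal = K⁻¹ * (K * (P ((Φ.flow s) ⁻¹' A)).toReal) := by
        rw [← mul_assoc, inv_mul_cancel₀ hK.ne', one_mul]
    _ ≤ K⁻¹ * ((klDiv P (globalGibbs σ ab θb N Φ)).toReal + Real.log 2) :=
        mul_le_mul_of_nonneg_left h hKinv.le

/-- **Equilibrium rates are paid by the TRUE pre-shock law with the FIXED initial budget.** For continuous positive
local Gibbs profiles and `σ ≤ 1/2` there is `A ≥ 0` (the static budget `KL(λ_N ‖ G_N) ≤ A (N+1)` of
`exists_localGibbsLaw_dominated`, `G_N` the homogeneous Gibbs law at unit activity and temperature) such that for EVERY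
`N`, flow, time `s`, measurable phase-space event `E` and rate `r > 0`: `G_N(E) ≤ e^{−r(N+1)}` implies
`λ_N(Φ_s ∈ E) ≤ (A(N+1) + log 2)/(r(N+1))`. [folklore] -/
theorem trueLaw_prob_le_of_equilibriumRate {a₀ θ₀ : T3 → ℝ} {u₀ : T3 → V3} (ha : Continuous a₀)
    (hθ : Continuous θ₀) (hu : Continuous u₀) (ha0 : ∀ x, 0 < a₀ x) (hθ0 : ∀ x, 0 < θ₀ x)
    (hσ2 : σ ≤ 1 / 2) :
    ∃ A : ℝ, 0 ≤ A ∧ ∀ (N : ℕ) (Φ : HardSphereFlow (Torus.geometry (Fin 3)) (hsDiameter σ N) (N + 1))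
      (s : ℝ) (E : Set (Config (N + 1) (Fin 3) T3)), MeasurableSet E → ∀ r : ℝ, 0 < r →
      globalGibbs σ 1 1 N Φ E ≤ ENNReal.ofReal (Real.exp (-(r * ((N : ℝ) + 1)))) →
      ((localGibbsLaw σ a₀ u₀ θ₀ N Φ) ((Φ.flow s) ⁻¹' E)).toReal ≤
        (r * ((N : ℝ) + 1))⁻¹ * (A * ((N : ℝ) + 1) + Real.log 2) := by
  obtain ⟨A, b, hA, _hb, H⟩ :=
    LambertianContactSwapSwapGapGibbsDomination.exists_localGibbsLaw_dominated ha hθ hu ha0 hθ0 hσ2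
  refine ⟨A, hA, fun N Φ s E hE r hr hGE => ?_⟩
  have hKL := (H N Φ).2.2.1
  haveI := isProbabilityMeasure_localGibbsLaw ha hθ hu ha0 hθ0 hσ2 N Φ
  haveI : IsProbabilityMeasure (globalGibbs σ 1 1 N Φ) :=
    isProbabilityMeasure_localGibbsLaw continuous_const continuous_const continuous_const
      (fun _ => one_pos) (fun _ => one_pos) hσ2 N Φ
  have hfin : klDiv (localGibbsLaw σ a₀ u₀ θ₀ N Φ) (globalGibbs σ 1 1 N Φ) ≠ ⊤ :=
    ne_top_of_le_ne_top ENNReal.ofReal_ne_top hKL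
  have hrN : 0 < r * ((N : ℝ) + 1) := by positivity
  have h := globalGibbsBudget_event 1 1 Φ (localGibbsLaw σ a₀ u₀ θ₀ N Φ)
    (RestartPrinciple.IsentropicRegibbsification.localGibbsLaw_ac σ _ _ _ N Φ) hfin s hE hrN hGE
  refine h.trans (mul_le_mul_of_nonneg_left (add_le_add ?_ le_rfl) (inv_nonneg.2 hrN.le))
  exact ENNReal.toReal_le_of_le_ofReal (by positivity) hKL

/-! ## §2 The window functional of the coherent bounded non-blob content -/

/-- The particle average of the coherent bounded non-blob suprathermal content of the configuration `z` over the time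
window `[a, b]` (normalisation `w⁻¹`), peculiar velocities and drift test against the FROZEN field `us`, radial weight
`R`: the common shape of the functionals of `EquilibriumNonBlobCoherenceLD` (`a = 0`, `b = w`) and
`BoundedCoherentContentVanishes` (`a = s`, `b = s + w`, `us = u_s`). [folklore] -/
def contentAvg (N : ℕ) (Φ : HardSphereFlow (Torus.geometry (Fin 3)) (hsDiameter σ N) (N + 1)) (us : T3 → V3)
    (R : T3 → ℝ → ℝ) (Kstar K η κ r₀ D₀ w a b : ℝ) (z : Config (N + 1) (Fin 3) T3) : ℝ :=
  ((N : ℝ) + 1)⁻¹ * ∑ i : Fin (N + 1),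
    (if η * (w⁻¹ * ∫ r in a..b, ‖(Φ.flow r z i).2 - us (Φ.flow r z i).1‖ ^ 3) <
        ‖w⁻¹ • ∫ r in a..b, (R (Φ.flow r z i).1 (‖(Φ.flow r z i).2 - us (Φ.flow r z i).1‖ ^ 2)) •
          ((Φ.flow r z i).2 - us (Φ.flow r z i).1)‖ then
      w⁻¹ * ∫ r in a..b,
        (if Kstar < ‖(Φ.flow r z i).2 - us (Φ.flow r z i).1‖ ∧ ‖(Φ.flow r z i).2 - us (Φ.flow r z i).1‖ ≤ K ∧
            ¬ DriftBad κ r₀ D₀ us (Φ.flow r z) i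
         then ‖(Φ.flow r z i).2 - us (Φ.flow r z i).1‖ ^ 3 else 0)
    else 0)

/-- **Flow shift of the window functional.** On the good set, the functional over the window `[s, s+w]` is the
functional over `[0, w]` evaluated at `Φ_s z` (group property, `integral_window_shift`). [folklore] -/
theorem contentAvg_shift (Φ : HardSphereFlow (Torus.geometry (Fin 3)) (hsDiameter σ N) (N + 1)) (us : T3 → V3)
    (R : T3 → ℝ → ℝ) (Kstar K η κ r₀ D₀ w s : ℝ) {z : Config (N + 1) (Fin 3) T3} (hz : z ∈ Φ.good) :
    contentAvg N Φ us R Kstar K η κ r₀ D₀ w 0 w (Φ.flow s z) = contentAvg N Φ us R Kstar K η κ r₀ D₀ w s (s + w) z := by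
  have h1 : ∀ i : Fin (N + 1),
      ∫ r in (0 : ℝ)..w, ‖(Φ.flow r (Φ.flow s z) i).2 - us (Φ.flow r (Φ.flow s z) i).1‖ ^ 3 =
        ∫ r in s..(s + w), ‖(Φ.flow r z i).2 - us (Φ.flow r z i).1‖ ^ 3 := fun i =>
    integral_window_shift Φ hz (fun c => ‖(c i).2 - us (c i).1‖ ^ 3) s w
  have h2 : ∀ i : Fin (N + 1),
      ∫ r in (0 : ℝ)..w, (R (Φ.flow r (Φ.flow s z) i).1 (‖(Φ.flow r (Φ.flow s z) i).2 - us (Φ.flow r (Φ.flow s z) i).1‖ ^ 2)) •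
          ((Φ.flow r (Φ.flow s z) i).2 - us (Φ.flow r (Φ.flow s z) i).1) =
        ∫ r in s..(s + w), (R (Φ.flow r z i).1 (‖(Φ.flow r z i).2 - us (Φ.flow r z i).1‖ ^ 2)) •
          ((Φ.flow r z i).2 - us (Φ.flow r z i).1) := fun i =>
    integral_window_shift Φ hz (fun c => (R (c i).1 (‖(c i).2 - us (c i).1‖ ^ 2)) • ((c i).2 - us (c i).1)) s w
  have h3 : ∀ i : Fin (N + 1),
      ∫ r in (0 : ℝ)..w, (if Kstar < ‖(Φ.flow r (Φ.flow s z) i).2 - us (Φ.flow r (Φ.flow s z) i).1‖ ∧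
            ‖(Φ.flow r (Φ.flow s z) i).2 - us (Φ.flow r (Φ.flow s z) i).1‖ ≤ K ∧
            ¬ DriftBad κ r₀ D₀ us (Φ.flow r (Φ.flow s z)) i
          then ‖(Φ.flow r (Φ.flow s z) i).2 - us (Φ.flow r (Φ.flow s z) i).1‖ ^ 3 else 0) =
        ∫ r in s..(s + w), (if Kstar < ‖(Φ.flow r z i).2 - us (Φ.flow r z i).1‖ ∧
            ‖(Φ.flow r z i).2 - us (Φ.flow r z i).1‖ ≤ K ∧ ¬ DriftBad κ r₀ D₀ us (Φ.flow r z) i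
          then ‖(Φ.flow r z i).2 - us (Φ.flow r z i).1‖ ^ 3 else 0) := fun i =>
    integral_window_shift Φ hz (fun c => if Kstar < ‖(c i).2 - us (c i).1‖ ∧ ‖(c i).2 - us (c i).1‖ ≤ K ∧
      ¬ DriftBad κ r₀ D₀ us c i then ‖(c i).2 - us (c i).1‖ ^ 3 else 0) s w
  simp only [contentAvg, h1, h2, h3]

/-- **Pointwise bounds of the window functional**: `0 ≤ S ≤ K³` (each counted integrand lies in `[0, K³]`; no
integrability is needed). [folklore] -/
theorem contentAvg_mem_Icc (Φ : HardSphereFlow (Torus.geometry (Fin 3)) (hsDiameter σ N) (N + 1)) (us : T3 → V3)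
    (R : T3 → ℝ → ℝ) {Kstar K : ℝ} (η κ r₀ D₀ : ℝ) {w : ℝ} (a : ℝ) (hK : 0 ≤ K) (hw : 0 < w)
    (z : Config (N + 1) (Fin 3) T3) :
    contentAvg N Φ us R Kstar K η κ r₀ D₀ w a (a + w) z ∈ Icc 0 (K ^ 3) := by
  have hK3 : 0 ≤ K ^ 3 := pow_nonneg hK 3
  have hN : (0 : ℝ) < (N : ℝ) + 1 := by positivity
  -- each counted term lies in `[0, K³]`
  have hterm : ∀ i : Fin (N + 1),
      (if η * (w⁻¹ * ∫ r in a..(a + w), ‖(Φ.flow r z i).2 - us (Φ.flow r z i).1‖ ^ 3) <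
          ‖w⁻¹ • ∫ r in a..(a + w), (R (Φ.flow r z i).1 (‖(Φ.flow r z i).2 - us (Φ.flow r z i).1‖ ^ 2)) •
            ((Φ.flow r z i).2 - us (Φ.flow r z i).1)‖ then
        w⁻¹ * ∫ r in a..(a + w),
          (if Kstar < ‖(Φ.flow r z i).2 - us (Φ.flow r z i).1‖ ∧ ‖(Φ.flow r z i).2 - us (Φ.flow r z i).1‖ ≤ K ∧
              ¬ DriftBad κ r₀ D₀ us (Φ.flow r z) i
           then ‖(Φ.flow r z i).2 - us (Φ.flow r z i).1‖ ^ 3 else 0)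
      else 0) ∈ Icc 0 (K ^ 3) := by
    intro i
    set g : ℝ → ℝ := fun r =>
      if Kstar < ‖(Φ.flow r z i).2 - us (Φ.flow r z i).1‖ ∧ ‖(Φ.flow r z i).2 - us (Φ.flow r z i).1‖ ≤ K ∧
          ¬ DriftBad κ r₀ D₀ us (Φ.flow r z) i
      then ‖(Φ.flow r z i).2 - us (Φ.flow r z i).1‖ ^ 3 else 0 with hg
    have hg0 : ∀ r, 0 ≤ g r := fun r => by simp only [hg]; split_ifs <;> positivity
    have hgK : ∀ r, g r ≤ K ^ 3 := fun r => by
      simp only [hg]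
      split_ifs with h
      · exact pow_le_pow_left₀ (norm_nonneg _) h.2.1 3
      · exact hK3
    have hI0 : 0 ≤ ∫ r in a..(a + w), g r :=
      intervalIntegral.integral_nonneg (le_add_of_nonneg_right hw.le) fun r _ => hg0 r
    have hIK : ∫ r in a..(a + w), g r ≤ K ^ 3 * w := by
      have h := intervalIntegral.norm_integral_le_of_norm_le_const (a := a) (b := a + w) (C := K ^ 3) (f := g)
        fun r _ => by rw [Real.norm_eq_abs, abs_of_nonneg (hg0 r)]; exact hgK r
      rw [add_sub_cancel_left, abs_of_pos hw, Real.norm_eq_abs] at h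
      exact (le_abs_self _).trans h
    have hY0 : 0 ≤ w⁻¹ * ∫ r in a..(a + w), g r := mul_nonneg (inv_nonneg.2 hw.le) hI0
    have hYK : w⁻¹ * ∫ r in a..(a + w), g r ≤ K ^ 3 := by
      calc w⁻¹ * ∫ r in a..(a + w), g r ≤ w⁻¹ * (K ^ 3 * w) := mul_le_mul_of_nonneg_left hIK (inv_nonneg.2 hw.le)
        _ = K ^ 3 := by field_simp
    split_ifs
    · exact ⟨hY0, hYK⟩
    · exact ⟨le_rfl, hK3⟩
  unfold contentAvg
  constructor
  · exact mul_nonneg (inv_nonneg.2 hN.le) (Finset.sum_nonneg fun i _ => (hterm i).1)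
  · calc ((N : ℝ) + 1)⁻¹ * ∑ i : Fin (N + 1), _ ≤ ((N : ℝ) + 1)⁻¹ * ∑ _i : Fin (N + 1), K ^ 3 :=
          mul_le_mul_of_nonneg_left (Finset.sum_le_sum fun i _ => (hterm i).2) (inv_nonneg.2 hN.le)
      _ = K ^ 3 := by
          rw [Finset.sum_const, Finset.card_univ, Fintype.card_fin, nsmul_eq_mul]
          push_cast
          field_simp

/-! ## §3 The stub -/

/-- **STUB `stub_bridgeTransfer : EquilibriumNonBlobCoherenceLD → BoundedCoherentContentVanishes`** of line `Sketch`
(crux `ClampedTransferDock`, stmt-AtomisticToContinuum-16665): the equilibrium large deviation of the coherent bounded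
non-blob content, read at the frozen Euler field `u_s` (bounded and Lipschitz on the slab `[0, (t+T)/2]`) and at the rate
`r = 3K³(A+1)/ε`, is paid under the TRUE pre-shock law at every `s ∈ [0, t]` by the conserved global-Gibbs budget
`KL(λ_N ‖ G_N) ≤ A(N+1)` (`trueLaw_prob_le_of_equilibriumRate`), the window functional being the equilibrium one composed
with `Φ_s` on the good set (`contentAvg_shift`) and bounded by `K³` (`contentAvg_mem_Icc`). [folklore] -/
theorem stub_bridgeTransfer : EquilibriumNonBlobCoherenceLD → BoundedCoherentContentVanishes := by
  intro hEq a₀ θ₀ u₀ ha hθ hu ha0 hθ0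
  obtain ⟨σ₁, hσ₁, hEqσ⟩ := hEq 1 1 one_pos one_pos
  refine ⟨min σ₁ (1 / 2), lt_min hσ₁ one_half_pos, ?_⟩
  intro σ hσ hσ0 T ρ θ u hE Φ _hT0 t ht Kstar K η hK hKK hη
  have hσ₁' : σ < σ₁ := hσ0.trans_le (min_le_left _ _)
  have hσ2 : σ ≤ 1 / 2 := (hσ0.trans_le (min_le_right _ _)).le
  have hK0 : 0 < K := hK.trans_le hKK
  have hK3 : 0 < K ^ 3 := pow_pos hK0 3
  -- the velocity field on the slab `[0, (t+T)/2] × 𝕋³`: bounded by `max Cu 0`, `L`-Lipschitz in space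
  have ht₁ : 0 < (t + T) / 2 := by linarith [ht.1, ht.2]
  have ht₁T : (t + T) / 2 < T := by linarith [ht.2]
  have htt₁ : t ≤ (t + T) / 2 := by linarith [ht.2]
  have hsub : Icc 0 ((t + T) / 2) ⊆ Ico 0 T := Icc_subset_Ico_right ht₁T
  obtain ⟨Cu, hCu⟩ := hE.smooth_velocity.exists_norm_le_of_isCompact isCompact_Icc hsub
  obtain ⟨L, hL0, hL⟩ := exists_lipschitz_slab hE.smooth_velocity ht₁ ht₁T
  have hU0 : 0 ≤ max Cu 0 := le_max_right _ _
  -- the drift ceiling of the equilibrium input at `(U, L, K⋆, K, η)`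
  obtain ⟨D₁, hD₁, hEqD⟩ := hEqσ σ hσ hσ₁' Φ (max Cu 0) L Kstar K η hU0 hL0 hK hKK hη
  refine ⟨D₁, hD₁, fun D₀ hD₀ hD₀₁ r₀ ε hr₀ hε => ?_⟩
  -- the budget `A` and the rate `r`
  obtain ⟨A, hA0, hbudget⟩ := trueLaw_prob_le_of_equilibriumRate ha hθ hu ha0 hθ0 hσ2
  have hε0 : ε ≠ 0 := hε.ne'
  set r : ℝ := 3 * K ^ 3 * (A + 1) / ε with hrdef
  have hr : 0 < r := by positivity
  have hδ : 0 < ε / 3 := by positivity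
  obtain ⟨κ₀, hκ₀, hEqκ⟩ := hEqD D₀ hD₀ hD₀₁ r₀ (ε / 3) r hr₀ hδ hr
  refine ⟨κ₀, hκ₀, fun κ hκ => ?_⟩
  obtain ⟨τ₀, hτ₀, hEqτ⟩ := hEqκ κ hκ
  refine ⟨τ₀, hτ₀, fun τ hτ => ?_⟩
  have hτ0 : 0 < τ := hτ₀.trans_le hτ
  obtain ⟨N₀, hEqN⟩ := hEqτ τ hτ
  refine ⟨N₀, fun N hN R hRm hR0 hRle s hs => ?_⟩
  intro w P W cub Y qbar
  -- the frozen field `u_s`: continuous, bounded, Lipschitz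
  have hs₁ : s ∈ Icc 0 ((t + T) / 2) := ⟨hs.1, hs.2.trans htt₁⟩
  have huc : Continuous (u s) := (hE.smooth_velocity.isSmooth_slice (hsub hs₁)).continuous
  have hub : ∀ x, ‖u s x‖ ≤ max Cu 0 := fun x => (hCu s hs₁ x).trans (le_max_left _ _)
  have hul : ∀ x y, ‖u s x - u s y‖ ≤ L * Torus.euclidDist x y := fun x y => by
    have h := hL s hs₁ s hs₁ x y
    rwa [sub_self, abs_zero, zero_add] at h
  have hw : 0 < w := mul_pos hτ0 (Real.rpow_pos_of_pos (by positivity) _)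
  -- the equilibrium event `E = {δ < S₀}` and a measurable hull `E'`
  set E : Set (Config (N + 1) (Fin 3) T3) :=
    {z | ε / 3 < contentAvg N (Φ N) (u s) R Kstar K η κ r₀ D₀ w 0 w z} with hEdef
  have hGE : globalGibbs σ 1 1 N (Φ N) E ≤ ENNReal.ofReal (Real.exp (-(r * ((N : ℝ) + 1)))) :=
    hEqN N hN (u s) huc hub hul R hRm hR0 hRle
  set E' : Set (Config (N + 1) (Fin 3) T3) := toMeasurable (globalGibbs σ 1 1 N (Φ N)) E with hE'def
  have hE'm : MeasurableSet E' := measurableSet_toMeasurable _ _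
  have hEE' : E ⊆ E' := subset_toMeasurable _ _
  have hGE' : globalGibbs σ 1 1 N (Φ N) E' ≤ ENNReal.ofReal (Real.exp (-(r * ((N : ℝ) + 1)))) :=
    (measure_toMeasurable E).trans_le hGE
  -- the true-law price of the event at time `s`
  haveI : IsProbabilityMeasure P := isProbabilityMeasure_localGibbsLaw ha hθ hu ha0 hθ0 hσ2 N (Φ N)
  have h0 : 0 ≤ (r * ((N : ℝ) + 1))⁻¹ * (A * ((N : ℝ) + 1) + Real.log 2) := by
    have := Real.log_nonneg one_le_two
    positivity
  have hPE : P (((Φ N).flow s) ⁻¹' E') ≤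
      ENNReal.ofReal ((r * ((N : ℝ) + 1))⁻¹ * (A * ((N : ℝ) + 1) + Real.log 2)) :=
    (ENNReal.le_ofReal_iff_toReal_le (measure_ne_top _ _) h0).2 (hbudget N (Φ N) s E' hE'm r hr hGE')
  -- pointwise on the good set: `S_s z ≤ δ + K³ 1{Φ_s z ∈ E'}` (flow shift and `0 ≤ S_s ≤ K³`)
  have hptw : ∀ᵐ z ∂P, ENNReal.ofReal (contentAvg N (Φ N) (u s) R Kstar K η κ r₀ D₀ w s (s + w) z) ≤
      ENNReal.ofReal (ε / 3) + (((Φ N).flow s) ⁻¹' E').indicator (fun _ => ENNReal.ofReal (K ^ 3)) z := by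
    filter_upwards [ae_mem_good_localGibbsLaw σ a₀ θ₀ u₀ N (Φ N)] with z hz
    have hS := contentAvg_mem_Icc (Φ N) (u s) R (Kstar := Kstar) η κ r₀ D₀ s hK0.le hw z
    by_cases hδS : ε / 3 < contentAvg N (Φ N) (u s) R Kstar K η κ r₀ D₀ w s (s + w) z
    · have hzE : z ∈ ((Φ N).flow s) ⁻¹' E' := by
        refine hEE' ?_
        show ε / 3 < contentAvg N (Φ N) (u s) R Kstar K η κ r₀ D₀ w 0 w ((Φ N).flow s z)
        rwa [contentAvg_shift (Φ N) (u s) R Kstar K η κ r₀ D₀ w s hz]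
      simp only [Set.indicator_of_mem hzE]
      exact (ENNReal.ofReal_le_ofReal hS.2).trans le_add_self
    · exact (ENNReal.ofReal_le_ofReal (not_lt.1 hδS)).trans le_self_add
  -- the arithmetic of the rate: `K³ (A(N+1) + log 2)/(r(N+1)) ≤ ε/3`
  have hlog : Real.log 2 ≤ (N : ℝ) + 1 := by
    have h := Real.log_le_sub_one_of_pos two_pos
    have hN0 : (0 : ℝ) ≤ N := N.cast_nonneg
    linarith
  have hrN : 0 < r * ((N : ℝ) + 1) := by positivity
  have key : K ^ 3 * ((r * ((N : ℝ) + 1))⁻¹ * (A * ((N : ℝ) + 1) + Real.log 2)) ≤ ε / 3 := by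
    rw [← div_eq_inv_mul, ← mul_div_assoc, div_le_iff₀ hrN]
    have e : ε / 3 * (r * ((N : ℝ) + 1)) = K ^ 3 * ((A + 1) * ((N : ℝ) + 1)) := by
      rw [hrdef]
      field_simp
    rw [e]
    refine mul_le_mul_of_nonneg_left ?_ hK3.le
    rw [add_one_mul]
    linarith
  -- integrate
  show ∫⁻ z, ENNReal.ofReal (contentAvg N (Φ N) (u s) R Kstar K η κ r₀ D₀ w s (s + w) z) ∂P ≤ ENNReal.ofReal ε
  calc ∫⁻ z, ENNReal.ofReal (contentAvg N (Φ N) (u s) R Kstar K η κ r₀ D₀ w s (s + w) z) ∂P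
      ≤ ∫⁻ z, (ENNReal.ofReal (ε / 3) + (((Φ N).flow s) ⁻¹' E').indicator (fun _ => ENNReal.ofReal (K ^ 3)) z) ∂P :=
        lintegral_mono_ae hptw
    _ = ENNReal.ofReal (ε / 3) + ENNReal.ofReal (K ^ 3) * P (((Φ N).flow s) ⁻¹' E') := by
        rw [lintegral_add_left measurable_const, lintegral_const, measure_univ, mul_one,
          lintegral_indicator_const (((Φ N).measurable_flow s) hE'm)]
    _ ≤ ENNReal.ofReal (ε / 3) +
          ENNReal.ofReal (K ^ 3) * ENNReal.ofReal ((r * ((N : ℝ) + 1))⁻¹ * (A * ((N : ℝ) + 1) + Real.log 2)) := by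
        gcongr
    _ = ENNReal.ofReal (ε / 3 + K ^ 3 * ((r * ((N : ℝ) + 1))⁻¹ * (A * ((N : ℝ) + 1) + Real.log 2))) := by
        rw [← ENNReal.ofReal_mul hK3.le, ← ENNReal.ofReal_add hδ.le (mul_nonneg hK3.le h0)]
    _ ≤ ENNReal.ofReal ε := ENNReal.ofReal_le_ofReal (by linarith)

end Summit.AtomisticToContinuum.HydrodynamicLimit.Theorems.ClampedTransferDockBridge

end
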